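import Literature.MathematicalPhysics.QuantumFieldTheory.Chatterjee2019LargeN.LatticeStrings
import Literature.MathematicalPhysics.QuantumFieldTheory.Chatterjee2019LargeN
import Literature.MathematicalPhysics.QuantumFieldTheory.Sweep1
import Literature.MathematicalPhysics.QuantumLattice.GaugeGroups
import HarnessLib

/-!
# Chatterjee 2019: strongly coupled `SO(N)` lattice gauge theory in the large-`N` limit — the theorems of §3 as named facts

S. Chatterjee, *Rigorous solution of strongly coupled `SO(N)` lattice gauge theory in the large `N`
limit*, Comm. Math. Phys. **366** (2019) 203–268 (arXiv:1502.07719), **§3 «Main result and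
corollaries»**. Statement-level transcription (named facts `def … : Prop`, D-0014; hypothesis-free
definitions of the printed objects) for the cross-ladder literature-typing layer (R141 (D), item
(3)); NOTHING about the lattice theory is proved here, and the open questions of §18 are NOT in this
file (they are author-stated questions, not results; see the typer's hand-off leaf).

## Relation to `Literature.MathematicalPhysics.QuantumFieldTheory.Chatterjee2019LargeN` (the flat module, p456300)

That module (cross-ladder item (3b), seat ym-lit-type-6) transcribes the RECTANGULAR-LOOP SLICES of
Theorem 3.1/Cor. 3.5 (`chatterjee_largeN_rectLoop`: the 't Hooft limit of `⟨W_{∂[R×T]}⟩/N` exists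
and is a power series in `β`), Cor. 3.2 (`chatterjee_largeN_factorization`, difference form),
Cor. 3.3 (`chatterjee_largeN_areaLaw`, `limsup` form with `area(∂[R×T]) = RT`) and Cor. 3.4/3.5
(`chatterjee_largeN_logPartition`), over abstract `SO(N)` models `ChatterjeeLargeN.IsSpecialOrthogonalModel ρ`,
and records as «Not transcribed: Thm 3.1's trajectory-sum formula itself and general loop
sequences; Thm 3.6 (finite-`N` master loop equation); §4 (the algorithm for `a_k`)». The present
module supplies exactly those: the statements for GENERAL loops and loop sequences with the
string-theoretic right-hand sides of §2 (`LatticeStrings`) written out — `∑_{X ∈ 𝒳(s)} w_β(X)`,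
`a_k(s) = ∑_{X ∈ 𝒳ₖ(s)} v(X)`, `area(l)` of a general loop via lattice surfaces — and Theorem 3.6.
It works with the CONCRETE group `SO N = Matrix.specialOrthogonalGroup (Fin N) ℝ` and its defining
representation `soRep N`, which is an `IsSpecialOrthogonalModel` (`isSpecialOrthogonalModel_soRep`,
proved), so every fact of the flat module specialises to the present setting; nothing there is
restated here.

## The model (§3 ¶1) in the tree's vocabulary

* `SO N = Matrix.specialOrthogonalGroup (Fin N) ℝ` (Mathlib; the tree's instances for
  `Matrix.specialUnitaryGroup n 𝕜`, `𝕜 = ℝ`, make it a compact second-countable measurable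
  group), `soRep N : SO N →* Matrix (Fin N) (Fin N) ℂ` its defining representation (real matrices
  read as complex ones, so that the tree's `ρ`-based API applies).
* «`Λ` a finite subset of `ℤ^d`», configurations `Q = (Q_e)_{e ∈ E⁺_Λ}` of `SO(N)` matrices,
  `dμ_{Λ,N,β}(Q) = Z⁻¹ exp(Nβ ∑_{p ∈ 𝒫⁺_Λ} tr Q_p) ∏ dσ_N(Q_e)` (§3 display) ↔
  `soMeasure N β Λ := zdWilsonMeasure (soRep N) (N * β) Λ` — the tree's free-boundary Wilson
  measure of `Sweep1` (weight `exp(-β' S_Λ)`, `S_Λ = ∑_{p ∈ plaquettesIn Λ} (N - Re tr ρ(U_p))`, at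
  `β' = Nβ`; the constant `e^{-N²β|𝒫_Λ|}` cancels in the normalisation, and `Re tr` of a real
  orthogonal matrix is its trace). `plaquettesIn Λ` = «plaquettes whose vertices are all in `Λ`» =
  `𝒫⁺_Λ`; the tree's plaquette holonomy `U.plaquette x i j` traverses `p` in the orientation
  opposite to Chatterjee's `e₁e₂e₃⁻¹e₄⁻¹` from the same base point, which does not change the
  trace of an orthogonal matrix (`tr Q⁻¹ = tr Qᵀ = tr Q`). The tree's measure lives on
  configurations of ALL edges of `ℤ^d` (product Haar outside `Λ`); its marginal on `E⁺_Λ` is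
  `μ_{Λ,N,β}`, so expectations of functions of the bonds in `Λ` — the only ones the source
  considers — agree (flag F1).
* `W_l = tr(Q_{e₁} ⋯ Q_{eₙ})`, `Q_{e⁻¹} = Q_e⁻¹`, `W_∅ = N` (§3) ↔ `wilsonLoopVar N l`
  (`wordHolonomy`, real trace); `⟨W_{l₁} ⋯ W_{lₙ}⟩/Nⁿ` ↔ `phi N β Λ s` for the loop sequence
  `s = (l₁, …, lₙ)` in minimal representation; `Z_{Λ,N,β}` ↔ `soPartitionFunction`.
* lattice surfaces = 2-chains `ZdPlaquette d →₀ ℤ`, the differential `δ`, the 1-chain `r(l)` of a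
  loop, `area(x) = ∑ |n_p|`, `area(l)` = minimal area of a lattice surface with boundary `l`
  (§3, before Cor. 3.3) ↔ `boundary`, `wordChain`, `surfaceArea`, `area`.
* loops, loop sequences, trajectories `𝒳(s)`, `𝒳ₖ(s)`, weights `w_β`, `v`, `δ(X)` and the operation
  sets are those of the sibling module `LatticeStrings` (§2).

## The results typed (all NAMED FACTS; locators of the CMP numbering = arXiv v7)

* `GaugeStringDuality` — **Theorem 3.1** (main result: for `|β| ≤ β₀(d)`,
  `lim_{N→∞} ⟨W_{l₁}⋯W_{lₙ}⟩_{Λ_N,N,β}/Nⁿ = ∑_{X ∈ 𝒳(s)} w_β(X)`, absolutely convergent).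
* `WilsonLoopFactorization` — **Corollary 3.2**.
* `AreaLawUpperBound` — **Corollary 3.3** (`lim |⟨W_l⟩|/N ≤ (C(d)|β|)^{area(l)}`).
* `LimitingPartitionFunction` — **Corollary 3.4**.
* `RealAnalyticityStrongCoupling`, `LogPartitionPowerSeries` — **Corollary 3.5** (both displays).
* `FiniteNMasterLoopEquation` — **Theorem 3.6** (finite-`N` master loop equation).

## Faithfulness flags

* (F1) Free boundary conditions on an arbitrary finite `Λ ⊆ ℤ^d`, as printed (via `Sweep1`'s
  `zdWilsonMeasure`, whose ambient product-Haar bonds outside `Λ` are invisible to the observables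
  used). `β` is any real number (the source allows `|β| ≤ β₀(d)` of either sign).
* (F2) «Let `Λ₁ ⊆ Λ₂ ⊆ ⋯` with `⋃ Λ_N = ℤ^d`» ↔ `Monotone Λ ∧ ∀ x, ∃ n, x ∈ Λ n`; the matrix size
  and the volume index are the same `N → ∞`, as printed. For `N = 0, 1` the terms are junk values of
  no consequence for the limits.
* (F3) Corollaries 3.3 and 3.4 say «Let all notation be as in Theorem 3.1»; we read this as
  including the hypothesis `|β| ≤ β₀(d)` (their limits exist by Theorem 3.1 only there), each fact
  carrying its own `∃ β₀ > 0` («depending only on `d`»). «`lim … ≤ …`» in Cor. 3.3 is rendered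
  «the limit exists and is `≤`».
* (F4) `area(l)` is an `sInf` over `ℕ` (value `0` on an empty set); the source notes that every
  loop bounds some lattice surface («It follows from standard facts about the cell complex of
  `ℤ^d`»), which is not proved here.
* (F5) `a_k(s) = ∑_{X ∈ 𝒳ₖ(s)} v(X)` is a finite sum in the source (finitely many trajectories with
  `k` deformations, §13); it is written as a `tsum` over the subtype `TrajectoryWith s k`, which IS
  that finite sum whenever the index type is finite. The second display of Cor. 3.5 prints
  `a_k(s)`; from Cor. 3.4 the intended sequence is the one-plaquette sequence `s = (p)`
  (`LogPartitionPowerSeries`).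
* (F6) Theorem 3.6: «all vertices that are at distance `≤ 1` from any `lᵢ` belong to `Λ`» ↔ every
  lattice point within Euclidean distance `1` (`latticeNorm`, `Sweep1`) of a vertex of some `lᵢ`
  lies in `Λ` (for lattice points this is the same as distance `≤ 1` from the traced polygon). The
  eight sums run over the finite operation index types of `LatticeStrings` (with multiplicity, as
  the source's counting conventions prescribe), `φ(s') = ⟨∏ W⟩/N^{#s'}` with `#s'` the number of
  loops of the re-minimised `s'`.
* (F7) Corollary 3.2's rider («`W_l/N` converges in probability to the deterministic limit») is the
  case `n = 2`, `l₁ = l₂ = l` combined with Chebyshev; it is quoted in the docstring, not typed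
  separately.

## References

* S. Chatterjee, Comm. Math. Phys. 366 (2019) 203–268, doi:10.1007/s00220-019-03353-3,
  arXiv:1502.07719: §3 (Theorem 3.1, Corollaries 3.2–3.5, Theorem 3.6; definitions of `μ_{Λ,N,β}`,
  `W_l`, lattice surfaces and `area(l)`), §4 (the recursion for `a_k`), §13 (finiteness of `𝒳ₖ`).
  [Chatterjee2019LargeN]
* E. Seiler, Phys. Rev. D 18 (1978) 482 (area-law lower bound for rectangles, quoted after Cor. 3.3).
-/

noncomputable section

open MeasureTheory Filter Topology
open Literature.Probability.LatticeModels Literature.MathematicalPhysics.QuantumLattice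

namespace Literature.MathematicalPhysics.QuantumFieldTheory.Chatterjee2019LargeN

variable {d : ℕ}

/-! ### §3 ¶1: `SO(N)` lattice gauge theory on a finite `Λ ⊆ ℤ^d` -/

/-- `SO(N)`, «the group of `N × N` orthogonal matrices with determinant `1`» (Mathlib's
`Matrix.specialOrthogonalGroup`, with the Haar probability measure `σ_N` supplied by the tree's
`haarProbability`). [cite: Chatterjee2019LargeN, §3 ¶1 (SO(N), Haar measure σ_N)] -/
abbrev SO (N : ℕ) : Type := ↥(Matrix.specialOrthogonalGroup (Fin N) ℝ)

/-- The defining representation of `SO(N)`, with real entries read in `ℂ` (so that the tree's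
representation-based lattice gauge API — `zdWilsonMeasure ρ β Λ` etc. — applies; `Re tr` of the
image is the real trace). [cite: Chatterjee2019LargeN, §3 ¶1 (SO(N) matrices Q_e)] -/
def soRep (N : ℕ) : SO N →* Matrix (Fin N) (Fin N) ℂ :=
  (RingHom.mapMatrix Complex.ofRealHom).toMonoidHom.comp
    (Matrix.specialOrthogonalGroup (Fin N) ℝ).subtype

/-- Unfolding of `soRep`: the complexified matrix of `Q`. [cite: Chatterjee2019LargeN, §3 ¶1] -/
theorem soRep_apply (N : ℕ) (Q : SO N) :
    soRep N Q = (Q : Matrix (Fin N) (Fin N) ℝ).map Complex.ofRealHom := rfl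

/-- The concrete `SO(N)` with its defining representation is an `SO(N)` model in the sense of the
flat module `Chatterjee2019LargeN` (`ChatterjeeLargeN.IsSpecialOrthogonalModel`: continuous,
faithful, image = `SO(N) ⊆ M_N(ℝ) ⊆ M_N(ℂ)`), so its facts `chatterjee_largeN_rectLoop`,
`chatterjee_largeN_factorization`, `chatterjee_largeN_areaLaw`, `chatterjee_largeN_logPartition`
specialise to the present setting. [cite: Chatterjee2019LargeN, §3 ¶1 (SO(N), σ_N)] -/
theorem isSpecialOrthogonalModel_soRep (N : ℕ) :
    ChatterjeeLargeN.IsSpecialOrthogonalModel (soRep N) := by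
  refine ⟨?_, ?_, ?_⟩
  · exact (continuous_subtype_val.matrix_map Complex.continuous_ofReal :)
  · intro a b h
    exact Subtype.ext (Matrix.map_injective Complex.ofReal_injective h)
  · ext M
    simp only [Set.mem_range, Set.mem_image, SetLike.mem_coe, soRep_apply]
    constructor
    · rintro ⟨Q, rfl⟩
      refine ⟨Q, Q.2, ?_⟩
      ext i j
      simp [Matrix.map_apply, Complex.coe_algebraMap]
    · rintro ⟨A, hA, rfl⟩
      refine ⟨⟨A, hA⟩, ?_⟩
      ext i j
      simp [Matrix.map_apply, Complex.coe_algebraMap]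

/-- **Chatterjee's lattice gauge measure** `μ_{Λ,N,β}` on `SO(N)` configurations of the finite region
`Λ ⊆ ℤ^d`: `dμ_{Λ,N,β}(Q) = Z_{Λ,N,β}⁻¹ exp(Nβ ∑_{p ∈ 𝒫⁺_Λ} tr Q_p) ∏_{e ∈ E⁺_Λ} dσ_N(Q_e)` — the
tree's free-boundary Wilson measure `zdWilsonMeasure (soRep N) (N * β) Λ` (`Sweep1`: weight
`exp(-Nβ ∑_{p ∈ plaquettesIn Λ} (N - Re tr ρ(U_p)))`, which differs from the printed density by the
constant factor `e^{-N²β |𝒫_Λ|}` absorbed by `Z`; product Haar on the bonds outside `Λ`, invisible to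
observables of the bonds in `Λ`; module docstring, flag F1). [cite: Chatterjee2019LargeN, §3 ¶1 (definition of μ_{Λ,N,β})] -/
def soMeasure (N : ℕ) (β : ℝ) (Λ : Finset (Literature.Probability.LatticeModels.Site d)) :
    Measure (ZdGaugeConfig d (SO N)) :=
  zdWilsonMeasure (soRep N) (N * β) Λ

/-- The expected value `⟨f⟩_{Λ,N,β} = ∫ f dμ_{Λ,N,β}` (display (3.1) of the source; Bochner integral,
junk `0` for non-integrable `f`). [cite: Chatterjee2019LargeN, §3 eq. (3.1) (⟨f⟩_{Λ,N,β})] -/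
def soExpect (N : ℕ) (β : ℝ) (Λ : Finset (Literature.Probability.LatticeModels.Site d))
    (f : ZdGaugeConfig d (SO N) → ℝ) : ℝ :=
  ∫ U, f U ∂(soMeasure N β Λ)

/-- `⟨f⟩_{Λ,N,β}` is the tree's `zdExpect (soRep N) (N * β) Λ f` (definitional).
[cite: Chatterjee2019LargeN, §3 eq. (3.1)] -/
theorem soExpect_eq_zdExpect (N : ℕ) (β : ℝ) (Λ : Finset (Literature.Probability.LatticeModels.Site d))
    (f : ZdGaugeConfig d (SO N) → ℝ) : soExpect N β Λ f = zdExpect (soRep N) (N * β) Λ f := rfl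

/-- **Chatterjee's partition function** `Z_{Λ,N,β} = ∫ exp(Nβ ∑_{p ∈ 𝒫⁺_Λ} tr Q_p) ∏_e dσ_N(Q_e)`
(the printed normalising constant itself — NOT the tree's `zdPartitionFunction`, which carries the
extra factor `e^{-N²β|𝒫_Λ|}`); the integral is taken against the product Haar probability measure
`zdHaar` on all bonds of `ℤ^d`, which integrates out the bonds outside `Λ` with weight one. The trace
of the tree's plaquette holonomy `U.plaquette x i j` equals `tr Q_p` (reversed orientation, same
trace for orthogonal matrices). [cite: Chatterjee2019LargeN, §3 ¶1 (Z_{Λ,N,β}), Cor. 3.4] -/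
def soPartitionFunction (N : ℕ) (β : ℝ) (Λ : Finset (Literature.Probability.LatticeModels.Site d)) :
    ℝ :=
  ∫ U, Real.exp (N * β * ∑ p ∈ plaquettesIn Λ,
      Matrix.trace ((ZdGaugeConfig.plaquette U p.1 p.2.1 p.2.2 : SO N) : Matrix (Fin N) (Fin N) ℝ))
    ∂(zdHaar d (SO N))

/-! ### §3: Wilson loop variables -/

/-- The holonomy `Q_{e₁} Q_{e₂} ⋯ Q_{eₙ}` of an edge word, with `Q_{e⁻¹} = Q_e⁻¹` (ordered product;
`1` for the null word). [cite: Chatterjee2019LargeN, §3 (W_l = tr(Q_{e₁}⋯Q_{eₙ}), Q_{e⁻¹} = Q_e⁻¹)] -/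
def wordHolonomy {G : Type*} [Group G] (U : ZdGaugeConfig d G) (l : Word d) : G :=
  (l.map fun a => if a.2 then U a.1 else (U a.1)⁻¹).prod

/-- The holonomy of the null word is `1`. [cite: Chatterjee2019LargeN, §3 (empty product = identity)] -/
@[simp] theorem wordHolonomy_nil {G : Type*} [Group G] (U : ZdGaugeConfig d G) :
    wordHolonomy U ([] : Word d) = 1 := rfl

/-- **The Wilson loop variable** `W_l = tr(Q_{e₁} Q_{e₂} ⋯ Q_{eₙ})` of `SO(N)` lattice gauge theory
(a real number; «By definition, `W_∅ = N`»). [cite: Chatterjee2019LargeN, §3 (Wilson loop variable W_l)] -/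
def wilsonLoopVar (N : ℕ) (l : Word d) (U : ZdGaugeConfig d (SO N)) : ℝ :=
  Matrix.trace ((wordHolonomy U l : SO N) : Matrix (Fin N) (Fin N) ℝ)

/-- `W_∅ = N`. [cite: Chatterjee2019LargeN, §3 («By definition, W_∅ = N»)] -/
theorem wilsonLoopVar_nil (N : ℕ) (U : ZdGaugeConfig d (SO N)) :
    wilsonLoopVar N ([] : Word d) U = N := by
  simp [wilsonLoopVar, Matrix.trace_one]

/-- The product `W_{l₁} W_{l₂} ⋯ W_{lₙ}` for a loop sequence `s = (l₁, …, lₙ)`.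
[cite: Chatterjee2019LargeN, §3 Thm. 3.1 (⟨W_{l₁}W_{l₂}⋯W_{lₙ}⟩)] -/
def wilsonProd (N : ℕ) (s : LoopSeq d) (U : ZdGaugeConfig d (SO N)) : ℝ :=
  (s.map fun l => wilsonLoopVar N l U).prod

/-- **`φ_{Λ,N,β}(s) = ⟨W_{l₁} W_{l₂} ⋯ W_{lₙ}⟩_{Λ,N,β} / Nⁿ`** for a loop sequence with minimal
representation `(l₁, …, lₙ)` (`φ(∅) = 1`). [cite: Chatterjee2019LargeN, §3 Thm. 3.6 and §5 (definition of φ(s))] -/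
def phi (N : ℕ) (β : ℝ) (Λ : Finset (Literature.Probability.LatticeModels.Site d)) (s : LoopSeq d) :
    ℝ :=
  soExpect N β Λ (wilsonProd N s) / (N : ℝ) ^ s.length

/-- A word `l` **lies in `Λ`**: all its edges belong to `E_Λ`, i.e. both endpoints of every edge are in
`Λ` («provided that the edges `e₁, …, eₙ` all belong to `E_Λ`»). [cite: Chatterjee2019LargeN, §3 (W_l defined for edges in E_Λ)] -/
def WordIn (Λ : Finset (Literature.Probability.LatticeModels.Site d)) (l : Word d) : Prop :=
  ∀ a ∈ l, DEdge.src a ∈ Λ ∧ DEdge.tgt a ∈ Λ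

/-- An exhausting increasing sequence of finite regions: «`Λ₁ ⊆ Λ₂ ⊆ ⋯` and `ℤ^d = ⋃ Λ_N`».
[cite: Chatterjee2019LargeN, §3 Thm. 3.1 (hypothesis on Λ_N)] -/
def IsExhaustion (Λ : ℕ → Finset (Literature.Probability.LatticeModels.Site d)) : Prop :=
  Monotone Λ ∧ ∀ x : Literature.Probability.LatticeModels.Site d, ∃ n, x ∈ Λ n

/-! ### §3: lattice surfaces and the minimal area of a loop (before Corollary 3.3) -/

/-- The 1-chain `r(e)` of a directed edge: `e` if `e ∈ E⁺`, `-e⁻¹` if `e ∈ E⁻` (1-chains = the free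
`ℤ`-module `ZdEdge d →₀ ℤ` over `E⁺`). [cite: Chatterjee2019LargeN, §3 (r(e), 1-chains)] -/
def edgeChain (a : DEdge d) : ZdEdge d →₀ ℤ := Finsupp.single a.1 (if a.2 then 1 else -1)

/-- The 1-chain `r(ρ) = r(e₁) + ⋯ + r(eₙ)` of a path (invariant under cyclic equivalence, hence
defined on loops). [cite: Chatterjee2019LargeN, §3 (r(ρ), r(l))] -/
def wordChain (ρ : Word d) : ZdEdge d →₀ ℤ := (ρ.map edgeChain).sum

/-- The differential of a positively oriented plaquette `p = e₁ e₂ e₃⁻¹ e₄⁻¹` (`eᵢ ∈ E⁺`):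
`δ p = e₁ + e₂ - e₃ - e₄`, i.e. the 1-chain of its plaquette word. [cite: Chatterjee2019LargeN, §3 (the differential map δ on plaquettes)] -/
def plaquetteChain (p : ZdPlaquette d) : ZdEdge d →₀ ℤ := wordChain (plaquetteWord p)

/-- **The differential (boundary) map** `δ` from lattice surfaces (2-chains, the free `ℤ`-module over
`𝒫⁺`) to 1-chains, the `ℤ`-linear extension of `p ↦ e₁ + e₂ - e₃ - e₄`.
[cite: Chatterjee2019LargeN, §3 (differential map δ, boundary of a 2-chain)] -/
def boundary : (ZdPlaquette d →₀ ℤ) →ₗ[ℤ] (ZdEdge d →₀ ℤ) :=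
  Finsupp.linearCombination ℤ plaquetteChain

/-- The area `area(x) = ∑_p |n_p|` of a lattice surface `x = ∑_p n_p p`.
[cite: Chatterjee2019LargeN, §3 (area of a lattice surface)] -/
def surfaceArea (x : ZdPlaquette d →₀ ℤ) : ℕ := x.sum fun _ n => n.natAbs

/-- A loop `l` **is the boundary of** the lattice surface `x`: `δ x = r(l)`.
[cite: Chatterjee2019LargeN, §3 («l is the boundary of a lattice surface x if δ(x) = r(l)»)] -/
def IsBoundaryOf (l : Word d) (x : ZdPlaquette d →₀ ℤ) : Prop := boundary x = wordChain l

/-- **The area of the minimal lattice surface enclosed by `l`**: the minimum of `area(x)` over all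
lattice surfaces `x` with boundary `l` (an `sInf` over `ℕ`, `0` if no surface bounds `l`; the source:
«for any loop `l` there exists at least one 2-chain `x` such that `δ(x) = r(l)`, and therefore
`area(l)` is well-defined», flag F4). [cite: Chatterjee2019LargeN, §3 (area(l), before Cor. 3.3)] -/
def area (l : Word d) : ℕ := sInf {A : ℕ | ∃ x : ZdPlaquette d →₀ ℤ, IsBoundaryOf l x ∧ surfaceArea x = A}

/-! ### §3 / §4: the power-series coefficients `a_k(s)` -/

/-- The coefficient `a_k(s) = ∑_{X ∈ 𝒳ₖ(s)} v(X)` of Corollary 3.5: the sum of the `β`-free weights of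
the vanishing trajectories from `s` with exactly `k` deformations (a finite sum, written as a `tsum`
over `TrajectoryWith s k`; flag F5). «If `s` is the null loop sequence, `a₀(s) = 1` and `a_k(s) = 0`
for `k > 0`» (§4). [cite: Chatterjee2019LargeN, Cor. 3.5 (a_k(s)), §4] -/
def coeffA (s : LoopSeq d) (k : ℕ) : ℝ := ∑' X : TrajectoryWith s k, X.1.vweight

/-! ### §3: the main theorem and its corollaries (NAMED FACTS) -/

variable (d)

/-- **Theorem 3.1 (Main result: solution of `SO(N)` lattice gauge theory and proof of gauge–string
duality in the 't Hooft limit).** «There exists a number `β₀(d) > 0`, depending only on the dimension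
`d`, such that the following is true. Let `Λ₁ ⊆ Λ₂ ⊆ ⋯` be any sequence of finite subsets of `ℤ^d`
such that `ℤ^d = ⋃ Λ_N`. If `|β| ≤ β₀(d)`, then for any loop sequence `s` with minimal representation
`(l₁, …, lₙ)`, `lim_{N→∞} ⟨W_{l₁} W_{l₂} ⋯ W_{lₙ}⟩_{Λ_N,N,β} / Nⁿ = ∑_{X ∈ 𝒳(s)} w_β(X)`, where `𝒳(s)`
is the set of all vanishing trajectories starting at `s` and `w_β(X)` is the weight of a trajectory
`X` … Moreover, the infinite sum is absolutely convergent.» Rendering: for `d ≥ 2` there is `β₀ > 0`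
such that for every exhaustion `Λ` (`IsExhaustion`), every `β` with `|β| ≤ β₀` and every genuine loop
sequence `s` (`IsLoopSeq`, minimal representation; the null sequence included, where both sides are
`1`), the family `X ↦ w_β(X)` on `Trajectory s` (= `𝒳(s)`, sibling module `LatticeStrings`) is
summable (absolute convergence in `ℝ`) and `φ_{Λ_N,N,β}(s) → ∑' X, w_β(X)` as `N → ∞` (flags F1–F2).
[cite: Chatterjee2019LargeN, Theorem 3.1] -/
def GaugeStringDuality : Prop :=
  2 ≤ d → ∃ β₀ : ℝ, 0 < β₀ ∧
    ∀ Λ : ℕ → Finset (Literature.Probability.LatticeModels.Site d), IsExhaustion Λ →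
      ∀ β : ℝ, |β| ≤ β₀ →
        ∀ s : LoopSeq d, IsLoopSeq s →
          Summable (fun X : Trajectory s => X.weight β) ∧
            Tendsto (fun N : ℕ => phi N β (Λ N) s) atTop (𝓝 (∑' X : Trajectory s, X.weight β))

/-- **Corollary 3.2 (Factorization of Wilson loops).** «Let all notation be as in Theorem 3.1, and
suppose that `|β| ≤ β₀(d)`. Then for any non-null loops `l₁, …, lₙ`,
`lim_{N→∞} ⟨W_{l₁} W_{l₂} ⋯ W_{lₙ}⟩_{Λ_N,N,β} / Nⁿ = lim_{N→∞} ∏ᵢ ⟨W_{lᵢ}⟩_{Λ_N,N,β} / N`. In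
particular, for any loop `l`, `⟨(W_l/N)²⟩` has the same limit as `⟨W_l/N⟩²` …, implying that the random
variable `W_l/N` converges in probability to the (deterministic) limit of `⟨W_l⟩/N` given in Theorem
3.1.» Rendering: for `d ≥ 2` there is `β₀ > 0` (that of Theorem 3.1) such that for every exhaustion,
`|β| ≤ β₀` and every genuine non-null loop sequence `s = (l₁, …, lₙ)` the single-loop limits
`Lᵢ = lim_N φ_{Λ_N,N,β}((lᵢ))` exist and `φ_{Λ_N,N,β}(s) → ∏ᵢ Lᵢ` (flag F7).
[cite: Chatterjee2019LargeN, Corollary 3.2] -/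
def WilsonLoopFactorization : Prop :=
  2 ≤ d → ∃ β₀ : ℝ, 0 < β₀ ∧
    ∀ Λ : ℕ → Finset (Literature.Probability.LatticeModels.Site d), IsExhaustion Λ →
      ∀ β : ℝ, |β| ≤ β₀ →
        ∀ s : LoopSeq d, IsLoopSeq s → s ≠ [] →
          ∃ L : Fin s.length → ℝ,
            (∀ i, Tendsto (fun N : ℕ => phi N β (Λ N) [s.get i]) atTop (𝓝 (L i))) ∧
              Tendsto (fun N : ℕ => phi N β (Λ N) s) atTop (𝓝 (∏ i, L i))

/-- **Corollary 3.3 (Area law upper bound in the 't Hooft limit).** «Let all notation be as in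
Theorem 3.1. Then for any non-null loop `l`, `lim_{N→∞} |⟨W_l⟩| / N ≤ (C(d)|β|)^{area(l)}`, where `C(d)`
is a positive constant that depends only on the dimension `d`, and `area(l)` is the area of the
minimal lattice surface enclosed by `l`» («To the best of my knowledge, no one has proved the area
law upper bound for general loops. The next corollary proves [it] in the 't Hooft limit at strong
coupling for general loops.»). Rendering: for `d ≥ 2` there are `β₀, C > 0` such that for every
exhaustion, every `|β| ≤ β₀` (flag F3) and every genuine non-null loop `l`, the limit
`L = lim_N |⟨W_l⟩_{Λ_N,N,β}| / N` exists and `L ≤ (C|β|)^{area l}` (`area`, flag F4).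
[cite: Chatterjee2019LargeN, Corollary 3.3] -/
def AreaLawUpperBound : Prop :=
  2 ≤ d → ∃ β₀ C : ℝ, 0 < β₀ ∧ 0 < C ∧
    ∀ Λ : ℕ → Finset (Literature.Probability.LatticeModels.Site d), IsExhaustion Λ →
      ∀ β : ℝ, |β| ≤ β₀ →
        ∀ l : Word d, IsLoop l → l ≠ [] →
          ∃ L : ℝ,
            Tendsto (fun N : ℕ => |soExpect N β (Λ N) (wilsonLoopVar N l)| / N) atTop (𝓝 L) ∧
              L ≤ (C * |β|) ^ area l

/-- **Corollary 3.4 (Limiting partition function of `SO(N)` lattice gauge theory).** «Let all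
notation be as in Theorem 3.1. Let `M_N` be a sequence of integers increasing to infinity, and suppose
that `Λ_N = [-M_N, M_N]^d ∩ ℤ^d`. Let `p` be any plaquette. Then
`lim_{N→∞} log Z_{Λ_N,N,β} / (N² |Λ_N|) = (β d(d-1)/2) ∑_{X ∈ 𝒳(p)} w_β(X)/(δ(X)+1)`, where `δ(X)` is
the number of deformations in the trajectory `X`.» Rendering: `Λ_N = box d (M N)` (the tree's centred
cube `{-M,…,M}^d`), `M` monotone and tending to `∞`, `|β| ≤ β₀` (flag F3), `Z` = `soPartitionFunction`
(the printed normalising constant), `p` any plaquette as the one-loop sequence `(p)`; the series on the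
right is recorded as summable (it is dominated by the absolutely convergent series of Theorem 3.1).
[cite: Chatterjee2019LargeN, Corollary 3.4] -/
def LimitingPartitionFunction : Prop :=
  2 ≤ d → ∃ β₀ : ℝ, 0 < β₀ ∧
    ∀ M : ℕ → ℕ, Monotone M → Tendsto M atTop atTop →
      ∀ β : ℝ, |β| ≤ β₀ →
        ∀ p : ZdPlaquette d,
          Summable (fun X : Trajectory [plaquetteWord p] => X.weight β / (X.numDeform + 1)) ∧
            Tendsto (fun N : ℕ =>
                Real.log (soPartitionFunction N β (box d (M N))) / ((N : ℝ) ^ 2 * (box d (M N)).card))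
              atTop
              (𝓝 (β * d * ((d : ℝ) - 1) / 2 *
                ∑' X : Trajectory [plaquetteWord p], X.weight β / (X.numDeform + 1)))

/-- **Corollary 3.5 (Real analyticity at strong coupling), first display.** «Let all notation be as
in Theorem 3.1, and assume that `|β| ≤ β₀(d)`. … For any non-null loop sequence `s` with minimal
representation `(l₁, …, lₙ)`, `lim_{N→∞} ⟨W_{l₁} W_{l₂} ⋯ W_{lₙ}⟩_{Λ_N,N,β} / Nⁿ = ∑_{k=0}^∞ a_k(s) β^k`,
where `a_k(s) = ∑_{X ∈ 𝒳ₖ(s)} v(X)` and the infinite series is absolutely convergent.» Rendering with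
`coeffA s k` (flag F5): the series `k ↦ a_k(s) β^k` is summable and is the limit of
`φ_{Λ_N,N,β}(s)`. [cite: Chatterjee2019LargeN, Corollary 3.5 (first display), §4 (algorithm for a_k)] -/
def RealAnalyticityStrongCoupling : Prop :=
  2 ≤ d → ∃ β₀ : ℝ, 0 < β₀ ∧
    ∀ Λ : ℕ → Finset (Literature.Probability.LatticeModels.Site d), IsExhaustion Λ →
      ∀ β : ℝ, |β| ≤ β₀ →
        ∀ s : LoopSeq d, IsLoopSeq s → s ≠ [] →
          Summable (fun k : ℕ => coeffA s k * β ^ k) ∧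
            Tendsto (fun N : ℕ => phi N β (Λ N) s) atTop (𝓝 (∑' k : ℕ, coeffA s k * β ^ k))

/-- **Corollary 3.5, second display (the rescaled log-partition function as a power series).** «The
rescaled log-partition function has a similar representation:
`lim_{N→∞} log Z_{Λ_N,N,β} / (N² |Λ_N|) = (d(d-1)/2) ∑_{k=0}^∞ a_k(s) β^{k+1}/(k+1)`, where, again, the
series is absolutely convergent.» Here (as in Cor. 3.4) `Λ_N = [-M_N, M_N]^d ∩ ℤ^d` and `s = (p)` is the
one-plaquette loop sequence (the display prints `a_k(s)`; flag F5).
[cite: Chatterjee2019LargeN, Corollary 3.5 (second display)] -/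
def LogPartitionPowerSeries : Prop :=
  2 ≤ d → ∃ β₀ : ℝ, 0 < β₀ ∧
    ∀ M : ℕ → ℕ, Monotone M → Tendsto M atTop atTop →
      ∀ β : ℝ, |β| ≤ β₀ →
        ∀ p : ZdPlaquette d,
          Summable (fun k : ℕ => coeffA [plaquetteWord p] k * β ^ (k + 1) / (k + 1)) ∧
            Tendsto (fun N : ℕ =>
                Real.log (soPartitionFunction N β (box d (M N))) / ((N : ℝ) ^ 2 * (box d (M N)).card))
              atTop
              (𝓝 ((d : ℝ) * ((d : ℝ) - 1) / 2 *
                ∑' k : ℕ, coeffA [plaquetteWord p] k * β ^ (k + 1) / (k + 1)))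

/-- **Theorem 3.6 (Finite `N` master loop equation).** «Fix a nonempty finite set `Λ ⊆ ℤ^d`, an
integer `N ≥ 2` and a real number `β`. Let `⟨·⟩` denote expectation with respect to the `SO(N)`
lattice gauge theory on `Λ` at inverse coupling strength `β`. For any non-null loop sequence `s` with
minimal representation `(l₁, …, lₙ)` such that each `lᵢ` is contained in `Λ`, define
`φ(s) = ⟨W_{l₁} ⋯ W_{lₙ}⟩ / Nⁿ`. … Let `s` be as above, and suppose that all vertices that are at
distance `≤ 1` from any `lᵢ` belong to `Λ`. Then
`(N-1)|s| φ(s) = ∑_{s' ∈ 𝕋⁻(s)} φ(s') - ∑_{s' ∈ 𝕋⁺(s)} φ(s') + N ∑_{s' ∈ 𝕊⁻(s)} φ(s')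
 - N ∑_{s' ∈ 𝕊⁺(s)} φ(s') + (1/N) ∑_{s' ∈ 𝕄⁻(s)} φ(s') - (1/N) ∑_{s' ∈ 𝕄⁺(s)} φ(s')
 + Nβ ∑_{s' ∈ 𝔻⁻(s)} φ(s') - Nβ ∑_{s' ∈ 𝔻⁺(s)} φ(s')`.» Rendering (flag F6): the sums run over the
finite index types `SameIdx s` (`𝕋⁻`, `𝕊⁺`), `InvIdx s` (`𝕋⁺`, `𝕊⁻`), `MergeIdx s` (`𝕄^±`),
`DeformIdx s` (`𝔻^±`) of `LatticeStrings`, with the result maps `negTwistAt`, `posTwistAt`,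
`negSplitAt`, `posSplitAt`, `negMergeAt`, `posMergeAt`, `negDeformAt`, `posDeformAt`; the vertex
hypothesis: every lattice point within Euclidean distance `1` of an endpoint of an edge of some `lᵢ`
lies in `Λ` (in particular each `lᵢ` lies in `Λ`). [cite: Chatterjee2019LargeN, Theorem 3.6] -/
def FiniteNMasterLoopEquation : Prop :=
  2 ≤ d → ∀ Λ : Finset (Literature.Probability.LatticeModels.Site d), Λ.Nonempty →
    ∀ N : ℕ, 2 ≤ N → ∀ (β : ℝ) (s : LoopSeq d), IsLoopSeq s → s ≠ [] →
      (∀ l ∈ s, ∀ a ∈ l, ∀ v : Literature.Probability.LatticeModels.Site d,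
          latticeNorm (v - DEdge.src a) ≤ 1 ∨ latticeNorm (v - DEdge.tgt a) ≤ 1 → v ∈ Λ) →
        ((N : ℝ) - 1) * (s.len : ℝ) * phi N β Λ s =
          (∑ o : SameIdx s, phi N β Λ (s.negTwistAt o)) - (∑ o : InvIdx s, phi N β Λ (s.posTwistAt o))
          + N * (∑ o : InvIdx s, phi N β Λ (s.negSplitAt o))
          - N * (∑ o : SameIdx s, phi N β Λ (s.posSplitAt o))
          + (1 / (N : ℝ)) * (∑ o : MergeIdx s, phi N β Λ (s.negMergeAt o))
          - (1 / (N : ℝ)) * (∑ o : MergeIdx s, phi N β Λ (s.posMergeAt o))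
          + N * β * (∑ o : DeformIdx s, phi N β Λ (s.negDeformAt o))
          - N * β * (∑ o : DeformIdx s, phi N β Λ (s.posDeformAt o))

end Literature.MathematicalPhysics.QuantumFieldTheory.Chatterjee2019LargeN

end
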